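import Mathlib.Combinatorics.HalesJewett
import Literature.Combinatorics.Additive.SzemerediTheorem
import HarnessLib

/-!
# The density Hales–Jewett theorem (statement) and Szemerédi's theorem from it

Topic `Literature/Combinatorics/HalesJewett` (next to Mathlib's `Combinatorics/HalesJewett.lean`,
which proves the colouring Hales–Jewett theorem and defines combinatorial lines
`Combinatorics.Line α ι`).

* `DensityHalesJewett` — the NAMED FACT (D-0014): H. Furstenberg, Y. Katznelson, *A density
  version of the Hales–Jewett theorem*, J. Anal. Math. 57 (1991), 64–119, Theorem E, in the
  wording of D. H. J. Polymath, *A new proof of the density Hales–Jewett theorem*, Ann. of Math.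
  175 (2012), Thm. 1.4 (p. 1285): "For every positive integer `k` and every real number `δ > 0`,
  there exists a positive integer `dhj(k, δ)` such that if `n ≥ dhj(k, δ)` and `A` is any subset
  of `[k]^n` of density at least `δ`, then `A` contains a combinatorial line." Words of `[k]^n`
  are `Fin n → Fin k`, lines are Mathlib's `Combinatorics.Line (Fin k) (Fin n)` (a word over
  `Fin k ∪ {∗}` with at least one wildcard `∗`; `l a` substitutes `a` for the wildcards), density
  at least `δ` is `δ k^n ≤ #A`. To be discharged along P. Dodos, V. Kanellopoulos, K. Tyros,
  *A simple proof of the density Hales–Jewett theorem*, IMRN 2014 (session plan in the notes of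
  the Green–Tao fact); nothing here depends on that.
* PROVED from it: `szemerediTheorem_of_densityHalesJewett :
  DensityHalesJewett → Literature.Combinatorics.Additive.SzemerediTheorem` (Polymath 2012,
  p. 1285: "the Hales–Jewett theorem easily implies van der Waerden's theorem, and likewise for
  the density versions"), via the digit-sum map `x ↦ ∑ᵢ xᵢ` (a line with `d ≥ 1` wildcards and
  constant part `C` goes to the progression `C, C + d, …, C + (k-1)d`, `digitSum_line`) and an
  averaging over translates `t < N` (`sum_card_translate_ge`) to pass from a dense
  `A ⊆ {0, …, N-1}` to a dense `{x ∈ [k]^n : t + ∑ xᵢ ∈ A}`.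

Consequently Green–Tao's Theorem 1.1 (`Literature.NumberTheory.Sieve.exists_prime_arithmetic_progression`)
rests, via `exists_prime_arithmetic_progression_of_szemerediTheorem`
(`NumberTheory/Sieve/GreenTao2008SzemerediExpectation.lean`), on `DensityHalesJewett` alone.

## References
* H. Furstenberg, Y. Katznelson, J. Anal. Math. 57 (1991), 64–119, Theorem E.
  [cite: FurstenbergKatznelson1991]
* D. H. J. Polymath, Ann. of Math. 175 (2012), 1283–1327, Thms. 1.2, 1.4 and p. 1285.
  [cite: Polymath2012DHJ]
* P. Dodos, V. Kanellopoulos, K. Tyros, Int. Math. Res. Not. 2014 (12), 3340–3352, Theorem 1.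
  [cite: DodosKanellopoulosTyros2014]
-/

open Finset


namespace Literature.Combinatorics.HalesJewett

/-- **The density Hales–Jewett theorem** (Furstenberg–Katznelson 1991, Theorem E; wording of
Polymath 2012, Thm. 1.4; Dodos–Kanellopoulos–Tyros 2014, Thm. 1): for every positive integer `k`
and every `δ > 0` there is `N = dhj(k, δ)` such that for all `n ≥ N`, every `A ⊆ [k]^n` with
`#A ≥ δ k^n` contains a combinatorial line `{ℓ(a) : a ∈ [k]}`. Named fact; users take
`(h : DensityHalesJewett)`. [cite: Polymath2012DHJ, Theorem 1.4] -/
def DensityHalesJewett : Prop :=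
  ∀ k : ℕ, 1 ≤ k → ∀ δ : ℝ, 0 < δ → ∃ N : ℕ, ∀ n : ℕ, N ≤ n → ∀ A : Finset (Fin n → Fin k),
    δ * (k : ℝ) ^ n ≤ #A → ∃ l : Combinatorics.Line (Fin k) (Fin n), ∀ a : Fin k, l a ∈ A

/-- The digit sum `φ(x) = ∑_i x_i` of a word `x ∈ [k]^n` (letters `0, …, k-1`). [folklore] -/
def digitSum {k n : ℕ} (x : Fin n → Fin k) : ℕ := ∑ i, (x i : ℕ)

/-- `φ(x) ≤ (k - 1) n ≤ k n`. [folklore] -/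
theorem digitSum_le {k n : ℕ} (x : Fin n → Fin k) : digitSum x ≤ k * n := by
  unfold digitSum
  calc ∑ i, (x i : ℕ) ≤ ∑ _i : Fin n, k := sum_le_sum fun i _ => (x i).isLt.le
    _ = k * n := by rw [sum_const, card_univ, Fintype.card_fin, smul_eq_mul, mul_comm]

/-- The constant part `C(ℓ) = ∑_{i fixed} ℓ_i` of a combinatorial line. [folklore] -/
def lineConst {k n : ℕ} (l : Combinatorics.Line (Fin k) (Fin n)) : ℕ :=
  ∑ i, (l.idxFun i).elim 0 (fun c : Fin k => (c : ℕ))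

/-- The number of wildcard coordinates of a combinatorial line. [folklore] -/
def lineWidth {k n : ℕ} (l : Combinatorics.Line (Fin k) (Fin n)) : ℕ :=
  #(univ.filter fun i => l.idxFun i = none)

/-- A combinatorial line has at least one wildcard. [folklore] -/
theorem lineWidth_pos {k n : ℕ} (l : Combinatorics.Line (Fin k) (Fin n)) : 0 < lineWidth l := by
  obtain ⟨i, hi⟩ := l.proper
  exact card_pos.2 ⟨i, mem_filter.2 ⟨mem_univ _, hi⟩⟩

/-- Along a combinatorial line the digit sum is an arithmetic progression:
`φ(ℓ(a)) = C(ℓ) + a · width(ℓ)`. [cite: Polymath2012DHJ, §1 (p. 1285)] -/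
theorem digitSum_line {k n : ℕ} (l : Combinatorics.Line (Fin k) (Fin n)) (a : Fin k) :
    digitSum (l a) = lineConst l + (a : ℕ) * lineWidth l := by
  unfold digitSum lineConst lineWidth
  rw [card_filter, mul_sum, ← sum_add_distrib]
  refine sum_congr rfl fun i _ => ?_
  rw [Combinatorics.Line.coe_apply]
  cases l.idxFun i <;> simp


/-- Averaging over translates: if `A ⊆ {0,…,N-1}` then some translate `t < N` satisfies
`#{x ∈ [k]^n : t + φ(x) ∈ A} ≥ #A - k n` on average, precisely
`k^n #A ≤ ∑_{t < N} #{x : t + φ(x) ∈ A} + k^n (k n)`. [cite: Polymath2012DHJ, §1 (p. 1285)] -/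
theorem sum_card_translate_ge {k n N : ℕ} {A : Finset ℕ} (hA : A ⊆ range N) :
    k ^ n * #A ≤ ∑ t ∈ range N, #(univ.filter fun x : Fin n → Fin k => t + digitSum x ∈ A) +
      k ^ n * (k * n) := by
  classical
  have hswap : ∑ t ∈ range N, #(univ.filter fun x : Fin n → Fin k => t + digitSum x ∈ A) =
      ∑ x : Fin n → Fin k, #((range N).filter fun t => t + digitSum x ∈ A) := by
    simp only [card_filter]
    exact sum_comm
  rw [hswap]
  have hx : ∀ x : Fin n → Fin k, #A ≤ #((range N).filter fun t => t + digitSum x ∈ A) + k * n :=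
    fun x => (Literature.Combinatorics.Additive.card_le_card_filter_add_shift hA (digitSum x)).trans
      (Nat.add_le_add_left (digitSum_le x) _)
  calc k ^ n * #A = ∑ _x : Fin n → Fin k, #A := by
        rw [sum_const, card_univ, Fintype.card_fun, Fintype.card_fin, Fintype.card_fin, smul_eq_mul]
    _ ≤ ∑ x : Fin n → Fin k, (#((range N).filter fun t => t + digitSum x ∈ A) + k * n) :=
        sum_le_sum fun x _ => hx x
    _ = _ := by
        rw [sum_add_distrib, sum_const, card_univ, Fintype.card_fun, Fintype.card_fin,
          Fintype.card_fin, smul_eq_mul]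

/-- **Szemerédi's theorem from the density Hales–Jewett theorem** (Polymath 2012, p. 1285:
"the Hales–Jewett theorem easily implies van der Waerden's theorem, and likewise for the density
versions"). Here via the digit-sum map `x ↦ ∑_i x_i`, which sends a combinatorial line with `d`
wildcards to the progression `C, C + d, …, C + (k-1)d`, and an averaging over translates `t < N`
to pass from a dense `A ⊆ {0,…,N-1}` to a dense `{x ∈ [k]^n : t + ∑ x_i ∈ A}`.
[cite: Polymath2012DHJ, Theorem 1.2 from Theorem 1.4 (p. 1285)] -/
theorem szemerediTheorem_of_densityHalesJewett (h : DensityHalesJewett) :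
    Literature.Combinatorics.Additive.SzemerediTheorem := by
  classical
  intro k hk δ hδ
  obtain ⟨n₀, hn₀⟩ := h k hk (δ / 2) (half_pos hδ)
  -- work in dimension `n := n₀`; translates need `k n ≤ δ N / 2`
  refine ⟨⌈2 * k * n₀ / δ⌉₊ + 1, fun N hN A hA hcard => ?_⟩
  have hNpos : 0 < N := by omega
  have hNR : (0 : ℝ) < N := by exact_mod_cast hNpos
  have hkn : (k : ℝ) * n₀ ≤ δ * N / 2 := by
    have h1 : 2 * (k : ℝ) * n₀ / δ ≤ N := (Nat.le_ceil _).trans (by exact_mod_cast (by omega : ⌈2 * (k : ℝ) * n₀ / δ⌉₊ ≤ N))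
    rw [div_le_iff₀ hδ] at h1
    linarith
  -- the averaging
  have hsum := sum_card_translate_ge (k := k) (n := n₀) hA
  have hkpow : (0 : ℝ) < (k : ℝ) ^ n₀ := by positivity
  obtain ⟨t, _ht, htA⟩ : ∃ t ∈ range N,
      δ / 2 * (k : ℝ) ^ n₀ ≤ #(univ.filter fun x : Fin n₀ → Fin k => t + digitSum x ∈ A) := by
    refine exists_le_of_sum_le (nonempty_range_iff.2 hNpos.ne') ?_
    rw [sum_const, card_range, nsmul_eq_mul]
    have h1 : (k : ℝ) ^ n₀ * #A ≤ (∑ t ∈ range N,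
        (#(univ.filter fun x : Fin n₀ → Fin k => t + digitSum x ∈ A) : ℝ)) + (k : ℝ) ^ n₀ * (k * n₀) := by
      exact_mod_cast hsum
    have h2 : (k : ℝ) ^ n₀ * (δ * N) ≤ (k : ℝ) ^ n₀ * #A := by gcongr
    have h3 : (k : ℝ) ^ n₀ * (k * n₀) ≤ (k : ℝ) ^ n₀ * (δ * N / 2) := by gcongr
    linarith
  -- DHJ in the translate
  obtain ⟨l, hl⟩ := hn₀ n₀ le_rfl (univ.filter fun x : Fin n₀ → Fin k => t + digitSum x ∈ A) htA
  refine ⟨t + lineConst l, lineWidth l, lineWidth_pos l, fun i hi => ?_⟩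
  have := (mem_filter.1 (hl ⟨i, lt_of_lt_of_le hi le_rfl⟩)).2
  rw [digitSum_line] at this
  simpa [add_assoc] using this

end Literature.Combinatorics.HalesJewett
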